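import Summits.CriticalPhenomena.Ising3DConformalLimit.Theses.SubPtolemyInterlacing
import Summits.CriticalPhenomena.Ising3DConformalLimit.Theorems.SubPtolemyFloor.Negative.ExponentWindow
import Summits.CriticalPhenomena.Ising3DConformalLimit.Theorems.SubPtolemyInterlacingSubPtolemyFloorLadder
import Summits.CriticalPhenomena.Ising3DConformalLimit.Theorems.SubPtolemyInterlacingSubPtolemyFloorPlusWallDecoupling
import HarnessLib

/-!
# `SubPtolemyFloor` ⇐ `WallCost`: the kernel certificate of the line `Sketch-plus-wall-quotient-ladder`
(crux item stmt-CriticalPhenomena-15703, route decl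
`Summit.CriticalPhenomena.Ising3DConformalLimit.Theses.SubPtolemyInterlacing.SubPtolemyFloor`;
checked skeleton `Cruxes/SubPtolemyFloor/Lines/Sketch_plus_wall_quotient_ladder.lean`, continuation lead
seat `prover-line-stmt-CriticalPhenomena-15703-c1-0`; idea card `Ideas/plus-wall-quotient-ladder.md`)

Notation (prose only): `g(n) = ⟨σ₀σ_{n e₁}⟩_{β_c(3)} = criticalTwoPoint 3 (n • e₁)` (axial critical two-point
function of the nearest-neighbour Ising model on `ℤ³`), `M_n = ⟨σ₀⟩⁺_{Λ_n;β_c,0} =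
isingCorr (zdGraph 3) (box 3 n) (criticalBeta 3) 0 .plus {0}` (plus-boundary magnetisation at the centre of
the box of radius `n`), `L = log₂(1+√2) = 1.2716` (the Ptolemy threshold of the route).

The crux is the axial floor `g(n) ≥ c n^{-a}` for some `a < L` (open problem; rigorous `a = 2`). This file
composes the two landed stubs of the line,
* S1 `stub_ladder` (zero-mass Fekete ladder: a polynomial floor plus `g(2n+2) ≤ C n^p g(n)²` give
  `g(n) ≥ c n^{-p}`), and
* S2 `stub_plusWallDecoupling` (`g(2n+2) ≤ M_n²`, Friedli–Velenik Exercise 3.15),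
into:
* `subPtolemyFloor_of_approxSubmult` — **architecture certificate**: ANY approximate submultiplicativity at
  the doubling scale `g(2n+2) ≤ C n^p g(n)²` with `0 ≤ p < L` proves the crux (the polynomial floor is the
  Simon–Lieb bound, landed as `SubPtolemyFloorNegative.floor_of_two_lt_threshold`);
* `stub_cruxOfWallCost` — **the line's certificate** (registered stub of the crux item): `WallCost(q)`,
  i.e. `M_n ≤ C n^q g(n)` for all `n ≥ 1` with `2q < L`, proves the crux (exponent `2·max(q,0)`);
* `wallCost_false_of_lt_half` — the engine is asked exactly in the OPEN window: `WallCost(q)` is FALSE for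
  every `q < 1/2` (it would give an axial exponent `< 1`, against the infrared window
  `SubPtolemyFloorNegative.exponent_ge_one`); truth `q = Δ_σ = 0.518`, threshold `L/2 = 0.6358`;
* `boxMag_ge_inv` — dividend: `M_n ≥ c/n` at `β_c(3)` (decoupling + Simon–Lieb).

What remains OPEN is exactly the antecedent of `stub_cruxOfWallCost`, the registered engine stub
`stub_wallCost` of the skeleton. No definitions, no named facts; pure composition over tree theorems.

References: S. Friedli, Y. Velenik, *Statistical Mechanics of Lattice Systems* (CUP 2017), Exercise 3.15
(decoupling); B. Simon, CMP 77 (1980) 111 and E. Lieb, CMP 77 (1980) 127 (polynomial floor);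
H. Duminil-Copin, *Lectures on the Ising and Potts models*, 2019, Thm. 4.8 (two-point bounds, in tree as
`criticalTwoPoint_bounds_holds`); H. Duminil-Copin, ICM 2022 §8.4 (the exponents of the 3D model are open).
-/

noncomputable section

namespace Summit.CriticalPhenomena.Ising3DConformalLimit.SubPtolemyFloorPlusWall

open scoped BigOperators Classical
open Finset Literature.Probability.LatticeModels
open Summit.CriticalPhenomena.Ising3DConformalLimit.Theses.SubPtolemyInterlacing

/-- `M_n = ⟨σ₀⟩⁺_{Λ_n;β_c,0} ≥ 0` (first Griffiths inequality in the plus box). [cite: FriedliVelenik2017, Thm. 3.20, eq. (3.21), p. 109] -/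
theorem boxMag_nonneg (n : ℕ) :
    0 ≤ isingCorr (zdGraph 3) (box 3 n) (criticalBeta 3) 0 BoundaryCondition.plus {0} :=
  GKSInequalities.gks_one_holds (zdGraph 3) (criticalBeta_nonneg 3) le_rfl (Or.inr rfl)
    (Finset.singleton_subset_iff.2 (zero_mem_box 3 n))

/-- **Architecture certificate: the crux from ANY approximate submultiplicativity at the doubling scale
below the Ptolemy exponent.** If `g(2n+2) ≤ C n^p g(n)²` for all `n ≥ 1` with `0 ≤ p < log₂(1+√2)` and
`C > 0`, then `SubPtolemyFloor` holds with exponent `p`: the Simon–Lieb floor `g(n) ≥ c n^{-a₀}`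
(`SubPtolemyFloorNegative.floor_of_two_lt_threshold`) is the polynomial input of the ladder `stub_ladder`.
Every cut-and-iterate lower-bound architecture factors through this statement (card, budget table). [folklore] -/
theorem subPtolemyFloor_of_approxSubmult {p C : ℝ} (hp0 : 0 ≤ p) (hp : p < Real.logb 2 (1 + Real.sqrt 2))
    (hC : 0 < C)
    (h : ∀ n : ℕ, 1 ≤ n →
      criticalTwoPoint 3 (((2 * n + 2 : ℕ) : ℤ) • (Pi.single 0 1 : Site 3)) ≤
        C * (n : ℝ) ^ p * criticalTwoPoint 3 ((n : ℤ) • (Pi.single 0 1 : Site 3)) ^ 2) :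
    SubPtolemyFloor := by
  obtain ⟨a₀, c₀, -, hc₀, hfl⟩ :=
    SubPtolemyFloorNegative.floor_of_two_lt_threshold (T := 3) (by norm_num)
  obtain ⟨c, hc, hf⟩ := stub_ladder (fun n => criticalTwoPoint 3 ((n : ℤ) • (Pi.single 0 1 : Site 3)))
    p C hp0 hC ⟨c₀, a₀, hc₀, hfl⟩ (fun n hn => by exact_mod_cast h n hn)
  exact ⟨p, c, hp, hc, hf⟩

/-- **WallCost and the plus-wall decoupling give approximate submultiplicativity** with exponent
`2·max(q,0)`: `g(2n+2) ≤ M_n² ≤ (C n^q g(n))² ≤ C² n^{2 max(q,0)} g(n)²` (`n ≥ 1`; stub S2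
`stub_plusWallDecoupling`). [cite: FriedliVelenik2017, Exercise 3.15 (solution, App. C)] -/
theorem approxSubmult_of_wallCost {q C : ℝ} (hC : 0 < C)
    (hW : ∀ n : ℕ, 1 ≤ n →
      isingCorr (zdGraph 3) (box 3 n) (criticalBeta 3) 0 BoundaryCondition.plus {0} ≤
        C * (n : ℝ) ^ q * criticalTwoPoint 3 ((n : ℤ) • (Pi.single 0 1 : Site 3))) :
    ∀ n : ℕ, 1 ≤ n →
      criticalTwoPoint 3 (((2 * n + 2 : ℕ) : ℤ) • (Pi.single 0 1 : Site 3)) ≤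
        C ^ 2 * (n : ℝ) ^ (2 * max q 0) *
          criticalTwoPoint 3 ((n : ℤ) • (Pi.single 0 1 : Site 3)) ^ 2 := by
  intro n hn
  have hn1 : (1 : ℝ) ≤ n := by exact_mod_cast hn
  have hg0 : 0 ≤ criticalTwoPoint 3 ((n : ℤ) • (Pi.single 0 1 : Site 3)) :=
    criticalTwoPoint_nonneg' _
  have hq : (n : ℝ) ^ q ≤ (n : ℝ) ^ (max q 0) :=
    Real.rpow_le_rpow_of_exponent_le hn1 (le_max_left _ _)
  have h1 : isingCorr (zdGraph 3) (box 3 n) (criticalBeta 3) 0 BoundaryCondition.plus {0} ≤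
      C * (n : ℝ) ^ (max q 0) * criticalTwoPoint 3 ((n : ℤ) • (Pi.single 0 1 : Site 3)) :=
    (hW n hn).trans (mul_le_mul_of_nonneg_right (mul_le_mul_of_nonneg_left hq hC.le) hg0)
  calc criticalTwoPoint 3 (((2 * n + 2 : ℕ) : ℤ) • (Pi.single 0 1 : Site 3))
      ≤ isingCorr (zdGraph 3) (box 3 n) (criticalBeta 3) 0 BoundaryCondition.plus {0} ^ 2 :=
        stub_plusWallDecoupling n hn
    _ ≤ (C * (n : ℝ) ^ (max q 0) * criticalTwoPoint 3 ((n : ℤ) • (Pi.single 0 1 : Site 3))) ^ 2 :=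
        pow_le_pow_left₀ (boxMag_nonneg n) h1 2
    _ = C ^ 2 * (n : ℝ) ^ (2 * max q 0) *
          criticalTwoPoint 3 ((n : ℤ) • (Pi.single 0 1 : Site 3)) ^ 2 := by
        rw [mul_pow, mul_pow, ← Real.rpow_natCast ((n : ℝ) ^ max q 0) 2, ← Real.rpow_mul (by positivity)]
        norm_num [mul_comm]

/-- **The line's certificate (registered stub `stub_cruxOfWallCost`): the crux from `WallCost`.** If for some
`q` with `2q < log₂(1+√2)` and some `C > 0` the plus-box magnetisation obeys
`⟨σ₀⟩⁺_{Λ_n;β_c,0} ≤ C n^q ⟨σ₀σ_{n e₁}⟩_{β_c}` for all `n ≥ 1`, then `SubPtolemyFloor` holds, with axial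
exponent `2·max(q,0) < log₂(1+√2)` (decoupling S2 + ladder S1 + Simon–Lieb). The antecedent is the line's one
open stub `stub_wallCost` (truth `q = Δ_σ = 0.518`, threshold `0.6358`). [folklore] -/
theorem stub_cruxOfWallCost :
    (∃ q C : ℝ, 2 * q < Real.logb 2 (1 + Real.sqrt 2) ∧ 0 < C ∧ ∀ n : ℕ, 1 ≤ n →
      isingCorr (zdGraph 3) (box 3 n) (criticalBeta 3) 0 BoundaryCondition.plus {0} ≤
        C * (n : ℝ) ^ q * criticalTwoPoint 3 ((n : ℤ) • (Pi.single 0 1 : Site 3))) →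
    SubPtolemyFloor := by
  rintro ⟨q, C, hq, hC, hW⟩
  refine subPtolemyFloor_of_approxSubmult (p := 2 * max q 0) (by positivity) ?_ (by positivity)
    (approxSubmult_of_wallCost hC hW)
  rcases le_total q 0 with hq0 | hq0
  · rw [max_eq_right hq0, mul_zero]
    exact SubPtolemyFloorNegative.one_lt_threshold.le.trans_lt' one_pos
  · rwa [max_eq_left hq0]

/-- **The engine is asked exactly in the open window: `WallCost(q)` is FALSE for every `q < 1/2`.**
With the decoupling (S2) and the ladder (S1), `WallCost(q)` yields an axial floor with exponent
`2·max(q,0) < 1`, contradicting the infrared window `1 ≤ a` (`SubPtolemyFloorNegative.exponent_ge_one`,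
Fröhlich–Simon–Spencer). So `stub_wallCost` carries content only for `q ∈ [1/2, log₂(1+√2)/2) = [0.5, 0.6358)`.
[cite: DuminilCopin2019, Thm. 4.8, §4.4 (infrared bound)] -/
theorem wallCost_false_of_lt_half {q C : ℝ} (hq : q < 1 / 2) (hC : 0 < C) :
    ¬ ∀ n : ℕ, 1 ≤ n →
      isingCorr (zdGraph 3) (box 3 n) (criticalBeta 3) 0 BoundaryCondition.plus {0} ≤
        C * (n : ℝ) ^ q * criticalTwoPoint 3 ((n : ℤ) • (Pi.single 0 1 : Site 3)) := by
  intro hW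
  have hsub := approxSubmult_of_wallCost hC hW
  obtain ⟨a₀, c₀, -, hc₀, hfl⟩ :=
    SubPtolemyFloorNegative.floor_of_two_lt_threshold (T := 3) (by norm_num)
  have hp : 0 ≤ 2 * max q 0 := by positivity
  obtain ⟨c, hc, h⟩ := stub_ladder (fun n => criticalTwoPoint 3 ((n : ℤ) • (Pi.single 0 1 : Site 3)))
    (2 * max q 0) (C ^ 2) hp (by positivity) ⟨c₀, a₀, hc₀, hfl⟩ (fun n hn => by exact_mod_cast hsub n hn)
  have h1 := SubPtolemyFloorNegative.exponent_ge_one hc h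
  have h2 : 2 * max q 0 < 1 := by
    rcases le_total q 0 with hq0 | hq0
    · rw [max_eq_right hq0]; norm_num
    · rw [max_eq_left hq0]; linarith
  linarith

/-- **Dividend (Tasaki's mean-field one-arm bound): the plus-box magnetisation at `β_c(3)` decays no faster
than `1/n`**: `M_n ≥ c/n` for all `n ≥ 1`, from the decoupling (S2) `M_n² ≥ g(2n+2)` and the Simon–Lieb floor
`g(m) ≥ c m^{-2}` (tree theorem `criticalTwoPoint_bounds_holds`). This is the `d = 3` case of the one-arm lower
bound `φ¹_{Λ_n,β_c}[0 ↔ ∂Λ_n] = ⟨σ₀⟩⁺_{Λ_n,β_c} ≥ c/n`; ANY polynomial upper bound on this quantity in `d = 3` is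
an open problem (loc. cit., remark after Thm. 1.12) — which is what the engine `WallCost(q)`, `q < 1`, would give.
[cite: VanEngelenburgGarbanPanisSevero2025, Thm. 1.1 and the paragraph after it (Tasaki's argument in d = 3)] [cite: Tasaki1987, §3] -/
theorem boxMag_ge_inv :
    ∃ c : ℝ, 0 < c ∧ ∀ n : ℕ, 1 ≤ n →
      c * (n : ℝ)⁻¹ ≤ isingCorr (zdGraph 3) (box 3 n) (criticalBeta 3) 0 BoundaryCondition.plus {0} := by
  obtain ⟨c₀, C, hc₀, hb⟩ := criticalTwoPoint_bounds_holds (d := 3) le_rfl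
  refine ⟨Real.sqrt c₀ / 4, by positivity, fun n hn => ?_⟩
  have hn0 : (0 : ℝ) < n := by exact_mod_cast hn
  have hD := stub_plusWallDecoupling n hn
  have hF := (hb _ (SubPtolemyFloorNegative.axis_ne_zero (n := 2 * n + 2) (by omega))).1
  rw [Site.norm_eq_supNorm, SubPtolemyFloorNegative.supNorm_axis] at hF
  have e : (-(((3 : ℕ) : ℝ) - 1)) = -2 := by norm_num
  rw [e] at hF
  have hn1 : (1 : ℝ) ≤ n := by exact_mod_cast hn
  have hle : ((2 * n + 2 : ℕ) : ℝ) ≤ 4 * n := by push_cast; linarith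
  have hpos : (0 : ℝ) < ((2 * n + 2 : ℕ) : ℝ) := by positivity
  have hmono : (4 * (n : ℝ)) ^ (-(2 : ℝ)) ≤ ((2 * n + 2 : ℕ) : ℝ) ^ (-(2 : ℝ)) :=
    Real.rpow_le_rpow_of_nonpos hpos hle (by norm_num)
  have h4 : (4 * (n : ℝ)) ^ (-(2 : ℝ)) = ((n : ℝ)⁻¹ / 4) ^ 2 := by
    rw [Real.rpow_neg (by positivity), Real.rpow_two]; field_simp
  have hsq : (Real.sqrt c₀ / 4 * (n : ℝ)⁻¹) ^ 2 ≤
      isingCorr (zdGraph 3) (box 3 n) (criticalBeta 3) 0 BoundaryCondition.plus {0} ^ 2 := by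
    calc (Real.sqrt c₀ / 4 * (n : ℝ)⁻¹) ^ 2 = c₀ * ((n : ℝ)⁻¹ / 4) ^ 2 := by
          rw [mul_pow, div_pow, Real.sq_sqrt hc₀.le]; ring
      _ = c₀ * (4 * (n : ℝ)) ^ (-(2 : ℝ)) := by rw [h4]
      _ ≤ c₀ * ((2 * n + 2 : ℕ) : ℝ) ^ (-(2 : ℝ)) := mul_le_mul_of_nonneg_left hmono hc₀.le
      _ ≤ _ := hF.trans hD
  exact (pow_le_pow_iff_left₀ (by positivity) (boxMag_nonneg n) two_ne_zero).1 hsq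

end Summit.CriticalPhenomena.Ising3DConformalLimit.SubPtolemyFloorPlusWall

end
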